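import Mathlib.NumberTheory.Real.Irrational
import Mathlib.Tactic.Ring
import Mathlib.Tactic.Linarith
import Mathlib.Tactic.LinearCombination
import HarnessLib

/-!
# Venture HSemireg — doubly-even targets are never reached: the cross-term identity of the pair-block norm and the parity step
# (ENGINE-W PROBE5 §54, LEMMA 54.1 ∕ THEOREM 54) — kernel algebra

HONEST FRAMING. Lean index of the computation cell `pub-hsemireg`, widening group ENGINE-W (code A, seat `engine-w-1`, gen 16).
RING IDENTITIES AND INTEGER PARITY ONLY; the lattice `Λ_X(H; A, N)`, the hermitian form and «reached» enter BY VALUE (docstring). No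
abelian variety, sheaf, `Ext` group or semiregularity map is constructed; nothing here says that HC, HC_CM or HC_AV holds. Theorems only
(0 `def`, 0 named fact, 0 `sorry`). Companion of `PairBlockEvenPolarisationObstruction.lean` (THEOREM 30-J: even POLARISATION ⇒ never);
this file is its target-side twin (even TARGET ⇒ never).

SOURCE (the cell's own result, this seat): `widen/ENGINE-W/out/probe5/PROBE5-STIZ-A.md` §54 (v6.0; file `2e12e5a3bf53cedc`).
SETTING (by value): `m < 0` squarefree, `m ≠ −3`; `K = ℚ(ω)`, `F = K(√m)`, `F⁺ = ℚ(δ)`, `δ = (ω − ω̄)√m`, `δ² = −3m` (irrational);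
`H` ANY positive hermitian binary form over `O_K`, `d = det H`; target `(A, N)` with `d ∣ N = N′d`, `tN = A² − m`, `μ = (A + √m)∕t`, so
`tμ̄ = A − √m`, `tμ = A + √m`, `tμμ̄ = N`; `Λ_X = O_K² + μH̄⁻¹O_K²`; `𝒩(x) = t·xᵀHx̄ ∈ F⁺`; «reached» ⟹ some `x ∈ Λ_X` has `𝒩(x) = 1`.
LEMMA 54.1: for `x = u + μv`, `v = H̄⁻¹y`: `xᵀHx̄ = H[u] + μ̄·w + μ·w̄ + μμ̄·H[v]` with `w := uᵀHv̄ = uᵀȳ ∈ O_K` (as `Hv̄ = ȳ`, `vᵀH = yᵀ`),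
`d·H[v] = G[y] ∈ ℤ` (the adjoint form); hence `𝒩(x) = t·H[u] + N′·G[y] + A·(w + w̄) + √m·(w̄ − w)` and, writing `w = p + qω`,
`w + w̄ = 2p − q = Tr w`, `w̄ − w = −q(ω − ω̄)`, so `𝒩(x) = t·H[u] + N′·G[y] + A·Tr w − q·δ` (exact machine check 211∕211,
`codeA/thm54_check_A.py`). THEOREM 54: `t`, `N′` both even ⟹ `𝒩(x) ≠ 1` for all `x` (so never): `𝒩 = 1` forces `q = 0`, then `Tr w = 2p`
and `𝒩 ≡ 0 (mod 2)`. Such targets exist iff `m ≡ 1 (mod 4)`. What the kernel holds: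

* §1 **`cross_term_identity`** — in any commutative ring: from `t·μb = A − r`, `t·μ = A + r` the expansion
  `t·(P + μb·w + μ·wb + μ·μb·Q) = t·P + (t·μ·μb)·Q + A·(w + wb) + r·(wb − w)` (`ring` after substitution; `r` plays `√m`, `μb` plays `μ̄`,
  `wb` plays `w̄`, `P = H[u]`, `Q = H[v]`); `norm_rational_and_delta_parts` — with `w + wb = 2p − q`, `wb − w = −q·s₃` (`s₃ = ω − ω̄`) and
  `t·μ·μb·Q = N′·G` the value is `(t·P + N′·G + A·(2p − q)) − q·(r·s₃)`: rational part `t·P + N′·G + A·(2p − q)`, `δ`-part `−q`.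
* §2 **`doublyEven_norm_ne_one`** (THEOREM 54, kernel form) — integers `t, N′, P, G, A, p, q` with `t`, `N′` even: the pair of equations
  «`δ`-part `= 0`» (`q = 0`) and «rational part `= 1`» has no solution; `doublyEven_real_ne_one` — the same read in `ℝ` with an irrational `δ`:
  `(tP + N′G + A(2p − q) : ℝ) − q·δ ≠ 1`.
* §3 `doublyEven_target_mod_four` — `t·N′·d = A² − m` with `t`, `N′` even forces `4 ∣ A² − m`, hence `m % 4 ∈ {0, 1}`: for squarefree
  `m` (`m % 4 ≠ 0`) doubly-even targets live exactly at `m ≡ 1 (mod 4)`.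
WHAT IS NOT HERE: the model facts (`Λ_X`, `Hv̄ = ȳ`, integrality of `G`), irrationality of `δ` for the specific `m` (see
`PairBlockEvenPolarisationObstruction.lean` §4 for `m` squarefree `≠ −3`), THEOREM 53′.
-/

namespace Summit.Ventures.HSemireg.PairBlock

/-! ## §1 The cross-term identity -/

/-- **LEMMA 54.1's expansion** (any commutative ring): with `t·μ̄ = A − r` and `t·μ = A + r`,
`t·(P + μ̄·w + μ·w̄ + μμ̄·Q) = t·P + (tμμ̄)·Q + A·(w + w̄) + r·(w̄ − w)`. [kernel, `linear_combination`] -/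
theorem cross_term_identity {R : Type*} [CommRing R] (t μ μb A r P Q w wb : R)
    (h1 : t * μb = A - r) (h2 : t * μ = A + r) :
    t * (P + μb * w + μ * wb + μ * μb * Q) = t * P + (t * μ * μb) * Q + A * (w + wb) + r * (wb - w) := by
  linear_combination w * h1 + wb * h2

/-- **Rational and `δ`-parts.** If moreover `t·μ·μ̄·Q = N′·G` (`tμμ̄ = N`, `N·H[v] = N′·G[y]`), `w + w̄ = 2p − q`, `w̄ − w = −q·s₃`
(`w = p + qω`, `s₃ = ω − ω̄`), then `𝒩 = (t·P + N′·G + A·(2p − q)) − q·(r·s₃)` — rational part plus `(−q)` times `δ = r·s₃`. [kernel] -/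
theorem norm_rational_and_delta_parts {R : Type*} [CommRing R] (t μ μb A r P Q w wb N' G p q s₃ : R)
    (h1 : t * μb = A - r) (h2 : t * μ = A + r) (hQ : t * μ * μb * Q = N' * G)
    (htr : w + wb = 2 * p - q) (him : wb - w = -(q * s₃)) :
    t * (P + μb * w + μ * wb + μ * μb * Q) = (t * P + N' * G + A * (2 * p - q)) - q * (r * s₃) := by
  rw [cross_term_identity t μ μb A r P Q w wb h1 h2, hQ, htr, him]
  ring

/-! ## §2 THEOREM 54: the parity step -/

/-- **THEOREM 54 — kernel form.** With `t` and `N′` both even, the two equations «`δ`-part `= 0`» and «rational part `= 1`» of `𝒩(x) = 1`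
are incompatible: `q = 0` makes `t·P + N′·G + A·(2p − q) = t·P + N′·G + 2Ap` even. [kernel] -/
theorem doublyEven_norm_ne_one (t N' P G A p q : ℤ) (ht : Even t) (hN : Even N') :
    ¬ (q = 0 ∧ t * P + N' * G + A * (2 * p - q) = 1) := by
  rintro ⟨rfl, h⟩
  obtain ⟨t₁, rfl⟩ := ht
  obtain ⟨n₁, rfl⟩ := hN
  have key : 2 * (t₁ * P + n₁ * G + A * p) = 1 := by linear_combination h
  generalize t₁ * P + n₁ * G + A * p = X at key
  omega

/-- The same read in `ℝ` with an irrational `δ` (for `δ = √(−3m)`, `m` squarefree `≠ −3`, irrationality is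
`PairBlock.irrational_delta`): `(t·P + N′·G + A·(2p − q)) − q·δ ≠ 1`. [kernel] -/
theorem doublyEven_real_ne_one {δ : ℝ} (hδ : Irrational δ) (t N' P G A p q : ℤ) (ht : Even t) (hN : Even N') :
    ((t * P + N' * G + A * (2 * p - q) : ℤ) : ℝ) - (q : ℝ) * δ ≠ 1 := by
  intro h
  have hq : q = 0 := by
    by_contra hq0
    have hq' : (q : ℝ) ≠ 0 := by exact_mod_cast hq0
    apply hδ
    refine ⟨(((t * P + N' * G + A * (2 * p - q) - 1 : ℤ) : ℚ) / (q : ℚ)), ?_⟩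
    push_cast
    field_simp
    push_cast at h
    linarith
  subst hq
  have h1 : ((t * P + N' * G + A * (2 * p - 0) : ℤ) : ℝ) = 1 := by simpa using h
  have h2 : t * P + N' * G + A * (2 * p - 0) = 1 := by exact_mod_cast h1
  exact doublyEven_norm_ne_one t N' P G A p 0 ht hN ⟨rfl, h2⟩

/-! ## §3 Where doubly-even targets live -/

/-- `t·N′·d = A² − m` with `t`, `N′` even ⟹ `4 ∣ A² − m`, so `m ≡ A² ≡ 0 or 1 (mod 4)`; for squarefree `m` (`4 ∤ m`) this is
`m ≡ 1 (mod 4)` («such targets exist exactly at `m ≡ 1 (mod 4)`; none at `ℚ(i)`, `ℚ(√−2)`, `ℚ(√−5)`, …»). [kernel] -/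
theorem doublyEven_target_mod_four (t N' d A m : ℤ) (h : t * N' * d = A ^ 2 - m) (ht : Even t) (hN : Even N')
    (hm0 : m % 4 ≠ 0) : m % 4 = 1 := by
  obtain ⟨t₁, rfl⟩ := ht
  obtain ⟨n₁, rfl⟩ := hN
  have h4 : (4 : ℤ) ∣ A ^ 2 - m := ⟨t₁ * n₁ * d, by linarith [h]⟩
  have hA : A ^ 2 % 4 = 0 ∨ A ^ 2 % 4 = 1 := by
    rcases Int.even_or_odd A with ⟨k, rfl⟩ | ⟨k, rfl⟩
    · left; ring_nf; omega
    · right; ring_nf; omega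
  omega

end Summit.Ventures.HSemireg.PairBlock
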